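import Mathlib
import Literature.Topology.FourManifolds.PlanarAchiralWords
import Literature.Topology.FourManifolds.PlanarShadowWalk
import Literature.Topology.FourManifolds.BalancedPresentation
import HarnessLib

/-!
# Stub `stub_k4Lift` of line `Sketch` (k4-axis-calculus) for crux
# `ConvexBisection.PlanarAcyclicBisectionRigidity` (item stmt-SmoothPoincare4-15086)

**The lift of shadow walks to planar walks** (all syntactic over `PlanarAchiralWords.lean` and
`PlanarShadowWalk.lean`).  `ArcData n` is a monoid, `evalWord` is multiplicative; on three holes
`T_[0,1]^{±1}`, `T_[1,2]^{±1}` are units, giving `Φ : F₂ →* (ArcData 3)ˣ` with `evalWord 3 g = Φ (shadowWord g)` on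
the round sub-alphabet, and the boundary twists commute with the image of `Φ` (arc-word identities checked by
computation); so the positive twist of `g(c₀₁)` IS `Φ` of its shadow and that of `g(d)` is `T_d`.  The shadow
of the planar Hurwitz action is conjugation, so a shadow walk lifts move by move (always forward; sign multiset
`{+,+,−,−}` kept, signs read off shadows by the total exponent).  DOUBLE: the lifted state is a block form,
`TwistEq` letterwise.  BALL: ≤ 2 (Hurwitz move + rotation)s and one global conjugation give a positive block
`[d, x, y]` with shadows literally `x, y`, of monodromy `T_d · T_[0,1] · T_[1,2]`, whose arc words generate `F₃`
for each of the four central `d` (four certificates).  Uses nothing unproved.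
-/

noncomputable section

-- the prescribed namespace `Summit.<P>.<Sub>.…` duplicates `SmoothPoincare4` (P = Sub = SmoothPoincare4)
set_option linter.dupNamespace false

open Literature.Topology.FourManifolds Literature.Topology.FourManifolds.PlanarWords
open Literature.Topology.FourManifolds.PlanarShadow (F₂ gx gy IsPos XYPairs startState IsBallState
  IsDoubleState InShadowNormalForm shadowGen shadowWord shadowCurve shadowLetter IsXYGen IsCentralCurve
  shadowWord_append)

namespace Summit.SmoothPoincare4.SmoothPoincare4.Theorems.PlanarAcyclicBisectionRigidity.Sketch

namespace K4Lift
variable {n : ℕ}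

/-- Extensionality of arc data (permutation and arc-word function). [folklore] -/
theorem arc_ext {φ ψ : ArcData n} (h1 : φ.perm = ψ.perm) (h2 : φ.u = ψ.u) : φ = ψ := by
  cases φ; cases ψ; cases h1; cases h2; rfl

/-- Functoriality of the induced automorphism `xᵢ ↦ uᵢ x_{π i} uᵢ⁻¹`. [folklore] -/
@[simp] theorem aut_mul (φ ψ : ArcData n) : (ArcData.mul φ ψ).aut = φ.aut.comp ψ.aut := by
  ext i; simp [ArcData.aut, ArcData.mul, mul_assoc, Equiv.Perm.mul_apply]

/-- `ArcData n` is a monoid under composition (local instance). [folklore] -/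
local instance arcMonoid : Monoid (ArcData n) where
  mul := ArcData.mul
  one := ArcData.one
  mul_assoc φ ψ χ := arc_ext (mul_assoc _ _ _) <| funext fun i => by
    show (ArcData.mul φ ψ).aut (χ.u i) * (ArcData.mul φ ψ).u (χ.perm i) =
      φ.aut ((ArcData.mul ψ χ).u i) * φ.u ((ArcData.mul ψ χ).perm i)
    rw [aut_mul]; simp [ArcData.mul, mul_assoc, Equiv.Perm.mul_apply]
  one_mul φ := arc_ext (one_mul _) <| funext fun i => by
    show ArcData.one.aut (φ.u i) * 1 = φ.u i; simp [ArcData.aut, ArcData.one, FreeGroup.lift_of_eq_id]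
  mul_one φ := arc_ext (mul_one _) <| funext fun i => by show φ.aut 1 * φ.u ((1 : Equiv.Perm (Fin n)) i) = φ.u i; simp

/-- `evalWord` of a one-letter word. [folklore] -/
theorem evalWord_singleton (p : PGen) : evalWord n [p] = PGen.data n p := mul_one _

/-- `evalWord` is multiplicative. [folklore] -/
theorem evalWord_append (g h : List PGen) : evalWord n (g ++ h) = evalWord n g * evalWord n h := by
  induction g with
  | nil => exact (one_mul _).symm
  | cons p g ih => show PGen.data n p * evalWord n (g ++ h) = PGen.data n p * evalWord n g * _; rw [ih, mul_assoc]

/-- Notation: the arc datum of `T_[a,b]^{∓}` on three holes, the generators of `F₃`, `T_[a,b] · T_[0,1] · T_[1,2]`. -/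
local notation "T⟦" a ", " b ", " s "⟧" => PGen.data 3 (PGen.round a b s)
local notation "𝔵" => (FreeGroup.of (0 : Fin 3))
local notation "𝔶" => (FreeGroup.of (1 : Fin 3))
local notation "𝔷" => (FreeGroup.of (2 : Fin 3))
local notation "M⟦" a ", " b "⟧" => (T⟦a, b, false⟧ * (T⟦0, 1, false⟧ * T⟦1, 2, false⟧))

/-- The unfolding equations computing arc words on three holes (`simp [unf] <;> group` decides identities
of products of round twists). [folklore] -/
theorem unf : (∀ φ ψ : ArcData 3, (φ * ψ).perm = φ.perm * ψ.perm) ∧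
    (∀ (φ ψ : ArcData 3) (i : Fin 3), (φ * ψ).u i = φ.aut (ψ.u i) * φ.u (ψ.perm i)) ∧
    (1 : ArcData 3).perm = 1 ∧ (∀ i : Fin 3, (1 : ArcData 3).u i = 1) ∧
    (∀ (φ : ArcData 3) (i : Fin 3), φ.aut (FreeGroup.of i) = φ.u i * FreeGroup.of (φ.perm i) * (φ.u i)⁻¹) ∧
    (∀ (a b : ℕ) (s : Bool), (T⟦a, b, s⟧).perm = 1) ∧
    (∀ (a b : ℕ) (s : Bool) (i : Fin 3), (T⟦a, b, s⟧).u i = if a ≤ i.val ∧ i.val ≤ b then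
      (if s then (PGen.blockWord 3 a b)⁻¹ else PGen.blockWord 3 a b) else 1) ∧
    PGen.blockWord 3 0 1 = 𝔵 * 𝔶 ∧ PGen.blockWord 3 1 2 = 𝔶 * 𝔷 ∧ PGen.blockWord 3 0 0 = 𝔵 ∧
    PGen.blockWord 3 1 1 = 𝔶 ∧ PGen.blockWord 3 2 2 = 𝔷 ∧ PGen.blockWord 3 0 2 = 𝔵 * 𝔶 * 𝔷 :=
  ⟨fun _ _ => rfl, fun _ _ _ => rfl, rfl, fun _ => rfl, fun φ i => by simp [ArcData.aut], fun _ _ _ => rfl,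
    fun _ _ _ _ => rfl, by simp [PGen.blockWord, List.finRange_succ, mul_assoc]⟩

/-- The twelve arc-word identities: the boundary twists commute with `T_[0,1]`, `T_[1,2]`, which have
on-the-nose inverses (decided by computing arc words). [folklore] -/
theorem arc_ids : (∀ a b : ℕ, (a = b ∧ b ≤ 2) ∨ (a = 0 ∧ b = 2) →
      T⟦a, b, false⟧ * T⟦0, 1, false⟧ = T⟦0, 1, false⟧ * T⟦a, b, false⟧ ∧
        T⟦a, b, false⟧ * T⟦1, 2, false⟧ = T⟦1, 2, false⟧ * T⟦a, b, false⟧) ∧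
    T⟦0, 1, false⟧ * T⟦0, 1, true⟧ = 1 ∧ T⟦0, 1, true⟧ * T⟦0, 1, false⟧ = 1 ∧
      T⟦1, 2, false⟧ * T⟦1, 2, true⟧ = 1 ∧ T⟦1, 2, true⟧ * T⟦1, 2, false⟧ = 1 := by
  refine ⟨fun a b h => ?_, ?_, ?_, ?_, ?_⟩
  rcases h with ⟨hab, hb⟩ | ⟨rfl, rfl⟩
  subst hab
  interval_cases a
  all_goals try constructor
  all_goals exact arc_ext (by simp [unf]) <| funext fun i => by fin_cases i <;> simp [unf] <;> group

/-- The round twists `T_[0,1]`, `T_[1,2]` as units (on-the-nose inverses). [folklore] -/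
def uT : Fin 2 → (ArcData 3)ˣ
  | 0 => ⟨T⟦0, 1, false⟧, T⟦0, 1, true⟧, arc_ids.2.1, arc_ids.2.2.1⟩
  | 1 => ⟨T⟦1, 2, false⟧, T⟦1, 2, true⟧, arc_ids.2.2.2.1, arc_ids.2.2.2.2⟩

/-- `Φ : F₂ →* (ArcData 3)ˣ`, `x ↦ T_[0,1]`, `y ↦ T_[1,2]`. [folklore] -/
def Φ : F₂ →* (ArcData 3)ˣ := FreeGroup.lift uT

/-- A word in the round sub-alphabet acts as `Φ` of its shadow. [folklore] -/
theorem evalWord_xy {g : List PGen} (hg : ∀ q ∈ g, IsXYGen q) : evalWord 3 g = Φ (shadowWord g) := by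
  induction g with
  | nil => simp [PlanarShadow.shadowWord_nil]; rfl
  | cons q g ih =>
    obtain ⟨s, hs⟩ := hg q (by simp)
    show PGen.data 3 q * evalWord 3 g = _; rw [ih fun p hp => hg p (by simp [hp])]
    rcases hs with rfl | rfl <;> cases s <;>
      simp [Φ, uT, PlanarShadow.shadowGen, PlanarShadow.shadowWord, gx, gy, FreeGroup.lift_apply_of]

/-- The boundary twists commute with the image of `Φ` (eight arc-word identities). [folklore] -/
theorem cen_commute {a b : ℕ} (h : (a = b ∧ b ≤ 2) ∨ (a = 0 ∧ b = 2)) (z : F₂) :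
    Commute (T⟦a, b, false⟧) (Φ z : ArcData 3) := by
  refine FreeGroup.induction_on z (by simp) (fun i => ?_) (fun i hi => by rw [map_inv]; exact hi.units_inv_right)
    (fun x y hx hy => by rw [map_mul, Units.val_mul]; exact hx.mul_right hy)
  simp only [Φ, FreeGroup.lift_apply_of, Commute, SemiconjBy]
  fin_cases i; exacts [(arc_ids.1 a b h).1, (arc_ids.1 a b h).2]

/-- A balanced presentation whose relators kill all generators in every group is trivial. [folklore] -/
theorem presentsTrivial_of {P : BalancedPresentation 3}
    (h : ∀ (G : Type) [Group G] (f : Fin 3 → G), (∀ j, FreeGroup.lift f (P j) = 1) → ∀ i, f i = 1) :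
    P.PresentsTrivialGroup := by
  rw [BalancedPresentation.presentsTrivialGroup_iff_normalClosure_eq_top, eq_top_iff,
    ← FreeGroup.closure_range_of, Subgroup.closure_le]
  rintro _ ⟨i, rfl⟩
  have hmk : FreeGroup.lift PresentedGroup.of = PresentedGroup.mk (Set.range P) := FreeGroup.ext_hom _ _ fun x => FreeGroup.lift_apply_of
  exact PresentedGroup.mk_eq_one_iff.1
    (h _ PresentedGroup.of (fun j => by rw [hmk]; exact PresentedGroup.one_of_mem ⟨j, rfl⟩) i)

/-- THE FOUR CERTIFICATES: for each central `d` the arc words `r₀, r₁, r₂` of `T_d · T_[0,1] · T_[1,2]` generate `F₃`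
(explicit free-group identities, checked by computation), so the presentation is trivial (`X = B⁴`). [folklore] -/
theorem cert {a b : ℕ} (h : (a = b ∧ b ≤ 2) ∨ (a = 0 ∧ b = 2)) :
    BalancedPresentation.PresentsTrivialGroup (M⟦a, b⟧).u := by
  refine presentsTrivial_of fun G _ f hf => ?_
  set r := (M⟦a, b⟧).u with hr
  have H : ∀ (i : Fin 3) (w : FreeGroup (Fin 3)), FreeGroup.of i = w → FreeGroup.lift f w = 1 → f i = 1 :=
    fun i w e hw => by simpa [hw, FreeGroup.lift_apply_of] using congrArg (FreeGroup.lift f) e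
  suffices hs : f 0 = 1 ∧ f 1 = 1 ∧ f 2 = 1 by intro i; fin_cases i <;> simp [hs]
  rcases h with ⟨hab, hb⟩ | ⟨rfl, rfl⟩
  · subst hab
    interval_cases a
    · have ha := H 0 ((r 1)⁻¹ * r 2 * r 0) (by rw [hr]; simp [unf]; group) (by simp [hf])
      have hb := H 1 (𝔵⁻¹ * (r 2)⁻¹ * r 1) (by rw [hr]; simp [unf]; group) (by simp [hf, ha, FreeGroup.lift_apply_of])
      exact ⟨ha, hb, H 2 (𝔵 * 𝔶⁻¹ * 𝔵⁻¹ * r 2) (by rw [hr]; simp [unf]; group) (by simp [hf, ha, hb, FreeGroup.lift_apply_of])⟩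
    · have hb := H 1 ((r 0)⁻¹ * (r 2)⁻¹ * r 1) (by rw [hr]; simp [unf]; group) (by simp [hf])
      have ha := H 0 (r 0 * 𝔶⁻¹) (by rw [hr]; simp [unf]) (by simp [hf, hb, FreeGroup.lift_apply_of])
      exact ⟨ha, hb, H 2 (𝔵 * 𝔶⁻¹ * 𝔵⁻¹ * r 2) (by rw [hr]; simp [unf]; group) (by simp [hf, ha, hb, FreeGroup.lift_apply_of])⟩
    · have hc := H 2 (r 0 * (r 1)⁻¹ * r 2) (by rw [hr]; simp [unf]; group) (by simp [hf])
      have ha := H 0 (𝔷 * r 0 * (r 1)⁻¹ * r 0) (by rw [hr]; simp [unf]; group) (by simp [hf, hc, FreeGroup.lift_apply_of])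
      exact ⟨ha, H 1 (𝔵⁻¹ * r 0) (by rw [hr]; simp [unf]) (by simp [hf, ha, FreeGroup.lift_apply_of]), hc⟩
  · have hc := H 2 ((r 1)⁻¹ * r 2 * r 0 * (r 1)⁻¹ * r 2) (by rw [hr]; simp [unf]; group) (by simp [hf])
    have ha := H 0 (𝔷 * (r 2)⁻¹ * r 0) (by rw [hr]; simp [unf]; group) (by simp [hf, hc, FreeGroup.lift_apply_of])
    exact ⟨ha, H 1 (𝔵⁻¹ * (r 2)⁻¹ * r 1) (by rw [hr]; simp [unf]; group) (by simp [hf, ha, FreeGroup.lift_apply_of]), hc⟩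

/-- The good curves: type `(0,1)` or `(1,2)`, carried by a word in the round sub-alphabet. [folklore] -/
def GoodC : Set PlanarCurve := {c | ((c.a = 0 ∧ c.b = 1) ∨ (c.a = 1 ∧ c.b = 2)) ∧ ∀ q ∈ c.g, IsXYGen q}

/-- The round twist of a good curve is in the sub-alphabet. [folklore] -/
theorem good_round {c : PlanarCurve} (hc : c ∈ GoodC) (s : Bool) : IsXYGen (PGen.round c.a c.b s) := by
  rcases hc.1 with ⟨h1, h2⟩ | ⟨h1, h2⟩ <;> exact ⟨s, by simp [h1, h2]⟩

/-- The sub-alphabet is closed under formal inverses. [folklore] -/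
theorem xy_invWord {g : List PGen} (hg : ∀ q ∈ g, IsXYGen q) : ∀ q ∈ invWord g, IsXYGen q := by
  simp only [invWord, List.mem_reverse, List.mem_map]; rintro _ ⟨p, hp, rfl⟩
  obtain ⟨s, rfl | rfl⟩ := hg p hp <;> exact ⟨!s, by simp [PGen.inv]⟩

/-- Twist words of good curves stay in the sub-alphabet. [folklore] -/
theorem xy_twist {c : PlanarCurve} (hc : c ∈ GoodC) (s : Bool) : ∀ q ∈ c.twistWord s, IsXYGen q := by
  simp only [PlanarCurve.twistWord, List.mem_append, List.mem_singleton]; rintro q ((hq | rfl) | hq)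
  exacts [hc.2 q hq, good_round hc _, xy_invWord hc.2 q hq]

/-- Shadow of the formal inverse of a sub-alphabet generator. [folklore] -/
theorem shadowGen_inv {q : PGen} (hq : IsXYGen q) : shadowGen q.inv = (shadowGen q)⁻¹ := by
  obtain ⟨s, rfl | rfl⟩ := hq <;> cases s <;> simp [PGen.inv, PlanarShadow.shadowGen]

/-- Shadow of a one-letter word. [folklore] -/
theorem shadowWord_singleton (q : PGen) : shadowWord [q] = shadowGen q := by simp [PlanarShadow.shadowWord]

/-- Shadow of a formal inverse word (sub-alphabet). [folklore] -/
theorem sw_inv {g : List PGen} (hg : ∀ q ∈ g, IsXYGen q) : shadowWord (invWord g) = (shadowWord g)⁻¹ := by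
  induction g with
  | nil => simp [invWord, PlanarShadow.shadowWord_nil]
  | cons q g ih =>
    have e : invWord (q :: g) = invWord g ++ [q.inv] := by simp [invWord]
    rw [e, shadowWord_append, ih fun p hp => hg p (by simp [hp]), shadowWord_singleton,
      shadowGen_inv (hg q (by simp)), ← mul_inv_rev, ← shadowWord_singleton q, ← shadowWord_append]
    rfl

/-- The shadow of a twist word is the shadow letter. [folklore] -/
theorem sw_twist {c : PlanarCurve} (hc : c ∈ GoodC) (s : Bool) : shadowWord (c.twistWord s) = shadowLetter (c, s) := by
  have h1 : shadowGen (PGen.round c.a c.b true) = (shadowGen (PGen.round c.a c.b false))⁻¹ :=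
    shadowGen_inv (q := PGen.round c.a c.b false) (good_round hc false)
  simp only [PlanarCurve.twistWord, shadowWord_append, sw_inv hc.2, shadowWord_singleton]
  cases s <;> simp [PlanarShadow.shadowLetter, PlanarShadow.shadowCurve, h1, mul_assoc]

/-- Shadow of an image letter. [folklore] -/
theorem shadowLetter_image (h : List PGen) (e : PlanarCurve) (t : Bool) : shadowLetter (e.image h, t) = shadowWord h * shadowLetter (e, t) * (shadowWord h)⁻¹ := by
  cases t <;> simp [PlanarShadow.shadowLetter, PlanarShadow.shadowCurve, PlanarCurve.image, shadowWord_append, mul_assoc]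

/-- THE KEY SYNTACTIC IDENTITY: the shadow of the planar Hurwitz action is conjugation. [folklore] -/
theorem shadow_hurwitzAct {x y : Letter} (hx : x.1 ∈ GoodC) : shadowLetter (hurwitzAct x y) = shadowLetter x * shadowLetter y * (shadowLetter x)⁻¹ := by
  obtain ⟨c, s⟩ := x
  show shadowLetter (y.1.image (c.twistWord s), y.2) = _
  rw [shadowLetter_image, sw_twist hx]

/-- Flipping the sign inverts the shadow. [folklore] -/
theorem shadowLetter_flip (c : PlanarCurve) (s : Bool) : shadowLetter (c, !s) = (shadowLetter (c, s))⁻¹ := by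
  cases s <;> simp [PlanarShadow.shadowLetter]

/-- SEMANTICS (i): the positive twist of a good curve is `Φ` of its shadow. [folklore] -/
theorem eval_twist_xy {c : PlanarCurve} (hc : c ∈ GoodC) : evalWord 3 (c.twistWord true) = Φ (shadowLetter (c, true)) := by
  rw [evalWord_xy (xy_twist hc true), sw_twist hc]

/-- SEMANTICS (ii): the positive twist of a central-type curve carried by a sub-alphabet word is the
bare boundary twist (centrality). [folklore] -/
theorem eval_twist_cen {c : PlanarCurve} (hc : (c.a = c.b ∧ c.b ≤ 2) ∨ (c.a = 0 ∧ c.b = 2))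
    (hg : ∀ q ∈ c.g, IsXYGen q) : evalWord 3 (c.twistWord true) = T⟦c.a, c.b, false⟧ := by
  rw [PlanarCurve.twistWord, evalWord_append, evalWord_append, evalWord_xy hg,
    evalWord_xy (xy_invWord hg), sw_inv hg, map_inv, evalWord_singleton, Bool.not_true, ← (cen_commute hc _).eq, mul_assoc, Units.mul_inv, mul_one]

/-- Every element of `F₂` is the shadow of a word in the round sub-alphabet. [folklore] -/
theorem exists_xyWord (z : F₂) : ∃ g : List PGen, (∀ q ∈ g, IsXYGen q) ∧ shadowWord g = z := by
  refine FreeGroup.induction_on z ⟨[], by simp, rfl⟩ (fun i => ⟨[PGen.round i (i + 1) false], ?_⟩)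
    (fun i ⟨g, hg, hs⟩ => ⟨invWord g, xy_invWord hg, by rw [sw_inv hg, hs]⟩)
    (fun x y ⟨g, hg, hs⟩ ⟨g', hg', hs'⟩ => ⟨g ++ g', by simpa [or_imp, forall_and] using And.intro hg hg',
      by rw [shadowWord_append, hs, hs']⟩)
  fin_cases i <;> simp [IsXYGen, shadowWord_singleton, PlanarShadow.shadowGen, gx, gy]

/-- The total exponent `F₂ → ℤ`. [folklore] -/
def ε : F₂ →* Multiplicative ℤ := FreeGroup.lift fun _ => Multiplicative.ofAdd 1

/-- Signs are read off shadows (total exponent `ε`): positive shadow ⇒ positive letter. [folklore] -/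
theorem sign_of_shadow {c : PlanarCurve} {s : Bool} (hc : c ∈ GoodC) : (IsPos (shadowLetter (c, s)) → s = true) ∧ (IsPos (shadowLetter (c, s))⁻¹ → s = false) := by
  have hpos : ∀ z, IsPos z → ε z = Multiplicative.ofAdd 1 := fun z ⟨e, he⟩ => by
    rcases he with rfl | rfl <;> simp [ε, gx, gy, FreeGroup.lift_apply_of]
  have hsc : ε (shadowCurve c) = Multiplicative.ofAdd 1 := by rcases hc.1 with ⟨h1, h2⟩ | ⟨h1, h2⟩ <;>
    simp [PlanarShadow.shadowCurve, h1, h2, PlanarShadow.shadowGen, ε, gx, gy, FreeGroup.lift_apply_of]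
  cases s <;> refine ⟨fun h => ?_, fun h => ?_⟩ <;> (try rfl) <;>
    · have h1 := congrArg Multiplicative.toAdd (hpos _ h)
      simp [PlanarShadow.shadowLetter, hsc] at h1

/-- Two leading `true`s in a permutation of `[+,+,−,−]` force two `false`s. [folklore] -/
theorem perm_ttff {s s' : Bool} (h : List.Perm [true, true, s, s'] [true, true, false, false]) : s = false ∧ s' = false :=
  have h' := (h.cons_inv).cons_inv
  ⟨by simpa using h'.subset (by simp : s ∈ _), by simpa using h'.subset (by simp : s' ∈ _)⟩

/-- Moving the central letter past its right neighbour and rotating it to the back. [folklore] -/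
theorem rot {S₀ : ℕ × List Letter} {D ℓ : Letter} {rest : List Letter} (h : Reachable S₀ (3, D :: ℓ :: rest)) :
    Reachable S₀ (3, D :: rest ++ [hurwitzAct D ℓ]) :=
  Relation.ReflTransGen.tail (Relation.ReflTransGen.tail h (Or.inl (Move.hurwitz 3 [] rest D ℓ))) (Or.inl (Move.rotate 3 _ _))

/-- THE INVARIANT of a lifted state `(+d)·L·(−d)`: good letters, signs `{+,+,−,−}`, reachable. [folklore] -/
def Inv (S₀ : ℕ × List Letter) (d : PlanarCurve) : Set (List Letter) := {L | (∀ ℓ ∈ L, ℓ.1 ∈ GoodC) ∧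
  List.Perm (L.map Prod.snd) [true, true, false, false] ∧ Reachable S₀ (3, (d, true) :: (L ++ [(d, false)]))}

/-- Membership bookkeeping around two adjacent letters. [folklore] -/
theorem forall_split {P : Letter → Prop} (preL postL : List Letter) (u v : Letter) :
    (∀ ℓ ∈ preL ++ u :: v :: postL, P ℓ) ↔ (∀ ℓ ∈ preL ++ postL, P ℓ) ∧ P u ∧ P v := by
  simp only [List.mem_append, List.mem_cons, or_imp, forall_and, forall_eq]; tauto

/-- Good letters are stable under the Hurwitz action. [folklore] -/
theorem good_hurwitzAct {x y : Letter} (hx : x.1 ∈ GoodC) (hy : y.1 ∈ GoodC) : (hurwitzAct x y).1 ∈ GoodC :=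
  ⟨hy.1, fun q hq => by
    simp only [hurwitzAct, PlanarCurve.image, List.mem_append] at hq; exact hq.elim (xy_twist hx _ q) (hy.2 q)⟩

/-- THE STEP: both planar Hurwitz moves at an inner position preserve the invariant. [folklore] -/
theorem inv_step {S₀ : ℕ × List Letter} {d : PlanarCurve} {preL postL : List Letter} {x y : Letter}
    (h : preL ++ x :: y :: postL ∈ Inv S₀ d) :
    preL ++ hurwitzAct x y :: x :: postL ∈ Inv S₀ d ∧ preL ++ y :: hurwitzAct (y.1, !y.2) x :: postL ∈ Inv S₀ d := by
  obtain ⟨hgood, hperm, hreach⟩ := h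
  obtain ⟨hrest, hx, hy⟩ := (forall_split _ _ _ _).1 hgood
  have e : ∀ u v : Letter, (3, (d, true) :: (preL ++ u :: v :: postL ++ [(d, false)])) =
      (3, ((d, true) :: preL) ++ u :: v :: (postL ++ [(d, false)])) := fun u v => by simp
  have hsw : ∀ u v : Letter, u.2 = y.2 → v.2 = x.2 →
      List.Perm ((preL ++ u :: v :: postL).map Prod.snd) [true, true, false, false] := fun u v hu hv =>
    List.Perm.trans (by simpa [hu, hv] using (List.Perm.swap x.2 y.2 _).append_left (preL.map Prod.snd)) hperm
  rw [e] at hreach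
  exact ⟨⟨(forall_split _ _ _ _).2 ⟨hrest, good_hurwitzAct hx hy, hx⟩, hsw _ _ rfl rfl,
      (e _ _).symm ▸ Relation.ReflTransGen.tail hreach (Or.inl (Move.hurwitz 3 _ _ x y))⟩,
    ⟨(forall_split _ _ _ _).2 ⟨hrest, hy, good_hurwitzAct hy hx⟩, hsw _ _ rfl rfl,
      (e _ _).symm ▸ Relation.ReflTransGen.tail hreach (Or.inl (Move.hurwitzInv 3 _ _ x y))⟩⟩

/-- The shadow moves are symmetric (the inverse move undoes the move). [folklore] -/
theorem move_symm {s t : List F₂} (h : PlanarShadow.Move t s) : PlanarShadow.Move s t := by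
  cases h with
  | hurwitz pre post a b => simpa [mul_assoc] using PlanarShadow.Move.hurwitzInv pre post (a * b * a⁻¹) a
  | hurwitzInv pre post a b => simpa [mul_assoc] using PlanarShadow.Move.hurwitz pre post b (b⁻¹ * a * b)

/-- THE LIFT OF A SHADOW WALK, move by move (always forward in `PlanarWords`). [folklore] -/
theorem lift_walk {S₀ : ℕ × List Letter} {d : PlanarCurve} {s t : List F₂} (h : PlanarShadow.Reachable s t)
    (hs : ∃ L ∈ Inv S₀ d, L.map shadowLetter = s) : ∃ L ∈ Inv S₀ d, L.map shadowLetter = t := by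
  induction h with
  | refl => exact hs
  | tail _ hm ih =>
    obtain ⟨L, hL, hLs⟩ := ih
    cases (hm.elim id move_symm) with
    | hurwitz pre post p q =>
      obtain ⟨preL, rest, rfl, rfl, h1⟩ := List.map_eq_append_iff.1 hLs
      obtain ⟨x, rest', rfl, rfl, h2⟩ := List.map_eq_cons_iff.1 h1; obtain ⟨y, postL, rfl, rfl, rfl⟩ := List.map_eq_cons_iff.1 h2
      exact ⟨_, (inv_step hL).1, by simp [shadow_hurwitzAct (hL.1 x (by simp))]⟩
    | hurwitzInv pre post p q =>
      obtain ⟨preL, rest, rfl, rfl, h1⟩ := List.map_eq_append_iff.1 hLs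
      obtain ⟨x, rest', rfl, rfl, h2⟩ := List.map_eq_cons_iff.1 h1; obtain ⟨y, postL, rfl, rfl, rfl⟩ := List.map_eq_cons_iff.1 h2
      exact ⟨_, (inv_step hL).2, by
        simp [shadow_hurwitzAct (x := (y.1, !y.2)) (y := x) (hL.1 y (by simp)), shadowLetter_flip, mul_assoc]⟩

/-- BALL FINISH: from a block form with positive block `[d, x, y]` of shadows `(c x c⁻¹, c y c⁻¹)`, one global
conjugation by a word with shadow `c⁻¹` makes the positive monodromy literally `T_d · T_[0,1] · T_[1,2]`. [folklore] -/
theorem ball_finish {S₀ : ℕ × List Letter} {d x y : PlanarCurve} {B' : List PlanarCurve} {c : F₂}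
    (hd : IsCentralCurve d) (hx : x ∈ GoodC) (hy : y ∈ GoodC)
    (hsx : shadowLetter (x, true) = c * gx * c⁻¹) (hsy : shadowLetter (y, true) = c * gy * c⁻¹)
    (hreach : Reachable S₀ (3, blockForm [d, x, y] B')) : ∃ (n' : ℕ) (A' B'' : List PlanarCurve),
      Reachable S₀ (n', blockForm A' B'') ∧ (SeamTrivial n' A' ∨ TwistEq n' A' B'') := by
  obtain ⟨gc, hgc, hgcs⟩ := exists_xyWord c⁻¹
  refine ⟨3, [d, x, y].map (PlanarCurve.image gc), B'.map (PlanarCurve.image gc), ?_, Or.inl ?_⟩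
  · rw [show blockForm ([d, x, y].map (PlanarCurve.image gc)) (B'.map (PlanarCurve.image gc)) =
      (blockForm [d, x, y] B').map (fun l => (l.1.image gc, l.2)) by simp [blockForm, positiveWord, List.map_reverse, Function.comp_def]]
    exact Relation.ReflTransGen.tail hreach (Or.inl (Move.conj 3 gc _))
  · have hcar : ∀ e : PlanarCurve, (∀ q ∈ e.g, IsXYGen q) → ∀ q ∈ (e.image gc).g, IsXYGen q := fun e he q hq => by
      simp only [PlanarCurve.image, List.mem_append] at hq; exact hq.elim (hgc q) (he q)
    unfold SeamTrivial
    simp only [List.map, monodromy, positiveWord, List.flatMap_cons, List.flatMap_nil, List.append_nil,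
      evalWord_append, Letter.twistWord]
    rw [eval_twist_cen (c := d.image gc) hd.2 (hcar d (by simp [hd.1])),
      eval_twist_xy (c := x.image gc) ⟨hx.1, hcar x hx.2⟩, eval_twist_xy (c := y.image gc) ⟨hy.1, hcar y hy.2⟩,
      shadowLetter_image, shadowLetter_image, hsx, hsy, hgcs]
    simpa [mul_assoc, Φ, gx, gy, uT, FreeGroup.lift_apply_of, PlanarCurve.image] using cert hd.2

end K4Lift

open K4Lift in
/-- **Stub 3 of line `Sketch` — THE LIFT: shadow walks are planar walks.**  From a word in shadow
normal form `A = [d, g₁(c₀₁), h₁(c₁₂)]`, `B = [d, g₂(c₀₁), h₂(c₁₂)]` one extracts `w = x^{ḡ₁} y^{h̄₁}` and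
the shadow pairs `P = (x^{ḡ₁}, y^{h̄₁})`, `Q = (x^{ḡ₂}, y^{h̄₂}) ∈ XYPairs w`; every shadow state reachable
from `startState P Q` which is a ball or a double state is realised by a planar walk from `blockForm A B`
(same `n = 3`) to a block form `A′ · B̄′ʳᵉᵛ` with `SeamTrivial 3 A′`, resp. `TwistEq 3 A′ B′`. [folklore] -/
theorem stub_k4Lift (A B : List PlanarCurve) (hnf : InShadowNormalForm A B) :
    ∃ (w : F₂) (P Q : F₂ × F₂),
      P ∈ XYPairs w ∧ Q ∈ XYPairs w ∧
      ∀ t : List F₂, Literature.Topology.FourManifolds.PlanarShadow.Reachable (startState P Q) t →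
        (IsBallState t ∨ IsDoubleState t) →
        ∃ (n' : ℕ) (A' B' : List PlanarCurve),
          Reachable (3, blockForm A B) (n', blockForm A' B') ∧ (SeamTrivial n' A' ∨ TwistEq n' A' B') := by
  obtain ⟨d, g₁, h₁, g₂, h₂, hd, hxy, rfl, rfl, heq⟩ := hnf
  simp only [List.append_assoc, List.mem_append] at hxy
  refine ⟨_, (shadowCurve ⟨0, 1, g₁⟩, shadowCurve ⟨1, 2, h₁⟩), (shadowCurve ⟨0, 1, g₂⟩, shadowCurve ⟨1, 2, h₂⟩),
    ⟨⟨shadowWord g₁, rfl⟩, ⟨shadowWord h₁, rfl⟩, rfl⟩, ⟨⟨shadowWord g₂, rfl⟩, ⟨shadowWord h₂, rfl⟩, heq.symm⟩,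
    fun t ht htarget => ?_⟩
  -- the start state satisfies the invariant; lift the shadow walk; the lifted state has 4 good letters
  obtain ⟨L, ⟨hgood, hperm, hreach⟩, hLt⟩ := lift_walk (S₀ := (3, blockForm [d, ⟨0, 1, g₁⟩, ⟨1, 2, h₁⟩] [d, ⟨0, 1, g₂⟩, ⟨1, 2, h₂⟩]))
    (d := d) ht ⟨[(⟨0, 1, g₁⟩, true), (⟨1, 2, h₁⟩, true), (⟨1, 2, h₂⟩, false), (⟨0, 1, g₂⟩, false)],
      ⟨by simpa [GoodC] using ⟨fun q h => hxy q (by tauto), fun q h => hxy q (by tauto),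
          fun q h => hxy q (by tauto), fun q h => hxy q (by tauto)⟩,
        List.Perm.refl _, Reachable.refl _⟩, rfl⟩
  have hl := hperm.length_eq
  rcases L with _ | ⟨⟨c₀, s₀⟩, _ | ⟨⟨c₁, s₁⟩, _ | ⟨⟨c₂, s₂⟩, _ | ⟨⟨c₃, s₃⟩, _ | _⟩⟩⟩⟩ <;> simp at hl
  obtain ⟨g0, g1, g2, g3⟩ : c₀ ∈ GoodC ∧ c₁ ∈ GoodC ∧ c₂ ∈ GoodC ∧ c₃ ∈ GoodC :=
    ⟨hgood (c₀, s₀) (by simp), hgood (c₁, s₁) (by simp), hgood (c₂, s₂) (by simp), hgood (c₃, s₃) (by simp)⟩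
  rcases htarget with ⟨c, pre, post, rfl⟩ | ⟨k₁, k₂, hk₁, hk₂, rfl⟩
  · -- BALL: locate the chain, read the signs, bring to block form, finish
    rcases pre with _ | ⟨p₀, _ | ⟨p₁, _ | ⟨p₂, pre⟩⟩⟩ <;>
      simp only [List.nil_append, List.cons_append, List.map_cons, List.map_nil, List.cons.injEq] at hLt
    · obtain ⟨hx, hy, -⟩ := hLt
      obtain rfl : s₀ = true := (sign_of_shadow g0).1 (hx ▸ ⟨c, Or.inl rfl⟩)
      obtain rfl : s₁ = true := (sign_of_shadow g1).1 (hy ▸ ⟨c, Or.inr rfl⟩)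
      obtain ⟨rfl, rfl⟩ := perm_ttff hperm
      exact ball_finish (B' := [d, c₃, c₂]) hd g0 g1 hx hy hreach
    · obtain ⟨-, hx, hy, -⟩ := hLt
      obtain rfl : s₁ = true := (sign_of_shadow g1).1 (hx ▸ ⟨c, Or.inl rfl⟩)
      obtain rfl : s₂ = true := (sign_of_shadow g2).1 (hy ▸ ⟨c, Or.inr rfl⟩)
      obtain ⟨rfl, rfl⟩ := perm_ttff ((List.perm_middle (a := s₀) (l₁ := [true, true]) (l₂ := [s₃])).trans hperm)
      exact ball_finish (B' := [c₀.image (Letter.twistWord (d, true)), d, c₃]) hd g1 g2 hx hy (rot hreach)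
    · obtain ⟨-, -, hx, hy, -⟩ := hLt
      obtain rfl : s₂ = true := (sign_of_shadow g2).1 (hx ▸ ⟨c, Or.inl rfl⟩)
      obtain rfl : s₃ = true := (sign_of_shadow g3).1 (hy ▸ ⟨c, Or.inr rfl⟩)
      obtain ⟨rfl, rfl⟩ := perm_ttff ((List.perm_append_comm (l₁ := [true, true]) (l₂ := [s₀, s₁])).trans hperm)
      exact ball_finish (B' := [c₁.image (Letter.twistWord (d, true)), c₀.image (Letter.twistWord (d, true)), d])
        hd g2 g3 hx hy (rot (rot hreach))
    · exact absurd (congrArg List.length hLt.2.2.2) (by simp; omega)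
  · -- DOUBLE: the lifted state is a block form, `TwistEq` letterwise by the semantics of twists
    simp only [List.map_cons, List.map_nil, List.cons.injEq, and_true] at hLt
    obtain ⟨e0, e1, e2, e3⟩ := hLt
    obtain ⟨rfl, rfl⟩ : s₀ = true ∧ s₁ = true := ⟨(sign_of_shadow g0).1 (e0 ▸ hk₁), (sign_of_shadow g1).1 (e1 ▸ hk₂)⟩
    obtain ⟨rfl, rfl⟩ : s₂ = false ∧ s₃ = false := ⟨(sign_of_shadow g2).2 (by rw [e2, inv_inv]; exact hk₂),
      (sign_of_shadow g3).2 (by rw [e3, inv_inv]; exact hk₁)⟩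
    simp only [PlanarShadow.shadowLetter, if_true, Bool.false_eq_true, if_false, inv_inj] at e0 e1 e2 e3
    refine ⟨3, [d, c₀, c₁], [d, c₃, c₂], hreach, Or.inr (List.Forall₂.cons rfl (List.Forall₂.cons ?_
      (List.Forall₂.cons ?_ List.Forall₂.nil)))⟩ <;> simp [eval_twist_xy, PlanarShadow.shadowLetter, *]

end Summit.SmoothPoincare4.SmoothPoincare4.Theorems.PlanarAcyclicBisectionRigidity.Sketch
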